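import Summits.CriticalPhenomena.PercolationContinuityZ3.Theorems.PercNearOneGluingNoHeavyQuantLightResidDECLaw
import HarnessLib

/-!
# QUANT lane R8, T-DEC: THE PURE FORM `LightResidDECLaw` IS FALSE — top-affordability `x₁·M ≤ mean ρ` admits sub-floors above the
# sub-law's far-row capacity (census-1 gen 24, FINDING 2; answers prim-quant-arm-1 g50's "the pure form is yours to break", ARCH-G50 §6(d))

builds on p205010 (kernel theorem, internal audit signed; external expert review pending)

Support file (`--supports stmt-CriticalPhenomena-4575`), QUANT lane seat prim-quant-census-1 (gen 24); memo
`run/shared/lean/prim/quant/prim-quant-census-1/RESID-DEC-G24.md` §11.  Theorems only, standard axioms, no sorries.  Refutes the `@[conjecture]`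
`LightResidDECLaw := LightResidDECOn SibFamAff₃` of `…QuantLightResidDECLaw` (arm-1 g50); the node `LightResidDEC` (tree floors) is NOT touched.

THE COUNTEREXAMPLE.  `S = (q = 9/10, M = 10, ρ = ½δ₁ + ½δ₁₀, x₁ = 11/20)`: `ρ` is a probability law of mean `11/2 = x₁·M` (top-affordability with
EQUALITY — `Sib.AffOK` asks nothing more of `x₁`), beside two unit siblings `D = (q = 1/2, M = 0, ρ = δ₀, x₁ = 1)` (aff-OK at every floor `≤ 1/2`);
floor `x = q·x₁ = 99/200`, outer gate `a = 9/10`.  The units do not change the forest law (`flaw [D, D, S] = gate ρ q`) nor the scaled one, so the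
residual `resid a (wco a L) L` is `gate ρ (a q) = (19/100)·δ₀ + (81/200)·δ₁ + (81/200)·δ₁₀` for EVERY weight: mean `T = 891/200 > 2`, so layer `j′ = 1`
is dominant, and DEC(1) would force the far row `min (a x) (1/2) = 891/2000 ≤ P(N ≥ 2) = 81/200 = 810/2000` (`tail_ge_of_decAt`) — false.
(`ρ` is even tree-built: the opened law of `R¹(R⁹[1/2])`, whose TREE floor is `1/2 < 11/20`; at `x₁ = 1/2` every layer is IN.)  MECHANISM: for a
law with a positive low atom, `mean/M` exceeds the far-row capacity `P(N ≥ j′+1)` at intermediate layers; the residual inherits the deficit whenever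
the companions donate no slack — units (here), blob relays `R¹[q_e]` (exact LP: `[S′, E, E]`, `S′ = R⁰[.95](.8: δ₁ | .375: δ₂₀)` at `x₁ = .325 =
mean/M`, OUT at layers 3–19 for `q_e ∈ {x, 1/2, 9/10}`), or near-sure-rooted composite companions `R¹[.99](R¹[1/3])` at `a = .99` (OUT at layers
5–20, a window failure); with the TREE floor (`x₁ = .3` = least marginal) every one of these forests is IN at every layer and gate
(census-1 code `code/pure*.py`).  REPAIR (for the typer / arm-1): the law-level hypothesis must carry the row content of the sub-floor — e.g.
`SDECLight s.x₁ s.M s.ρ` (the light oracle) in place of `s.x₁·M ≤ s.mean`; that oracle form has no known counterexample.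

* `gate_deltaZero`, `flaw_cons_unit` (a unit sibling does not change the forest law), `flaw_single` (one sibling: the gated law),
  `resid_of_flaw_eq` (if the forest law is one gated law `gate ρ q` and the scaled one is `gate ρ (a q)`, the residual is `gate ρ (a q)` at any
  weight `w ≠ 1`);
* **`not_lightResidDECLaw : ¬ LightResidDECLaw`**.

HONEST STATUS: a refutation of the oracle-free pure form only; `LightResidDEC`, `ResidDEC`, `SiblingStep`, `GateStepN`, `FarTreeRow` OPEN and
untouched (their sub-floors are tree floors); RATE class log\* / honest sentence of `run/shared/lean/prim/quant/README.md` unchanged.  [this work];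
the conjecture and its family: prim-quant-arm-1 g50.  Nothing here is cited as a published result.  The gluing rows served
[cite: KozmaNitzan2024, Conjecture 3 (p. 15)]; product measure [cite: Grimmett1999, §1.3 p. 10].
-/

noncomputable section

open scoped BigOperators

namespace Summit.CriticalPhenomena.PercolationContinuityZ3.Theorems
namespace Quant

open Finset

namespace LawDec

/-- the zero law `δ₀` -/
local notation3 "δ0" => (fun h : ℕ => if h = 0 then (1 : ℝ) else 0)

/-- the counterexample's sub-forest law `ρ♭ = ½δ₁ + ½δ₁₀` -/
local notation3 "ρ♭" => (fun h : ℕ => (if h = 1 then (1 / 2 : ℝ) else 0) + (if h = 10 then (1 / 2 : ℝ) else 0))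

/-! ### Unit siblings do not change the forest law -/

/-- gating the zero law does nothing: `gate δ₀ q = δ₀`. [this work] -/
theorem gate_deltaZero (q : ℝ) : gate δ0 q = δ0 := by
  funext h
  simp only [gate]
  split_ifs <;> ring

/-- **a unit sibling (`M = 0`, `ρ = δ₀`) in front of a law-OK list does not change the forest law.** [this work] -/
theorem flaw_cons_unit (q x₁ : ℝ) (n : ℕ) (L : List Sib) (hL : ∀ s ∈ L, s.LawOK) :
    flaw (⟨q, x₁, n, 0, δ0⟩ :: L) = flaw L := by
  funext h
  show lconv (ftop L) 0 (flaw L) (gate δ0 q) h = flaw L h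
  rw [gate_deltaZero]
  exact lconv_delta_right (ftop L) 0 (flaw L) (flaw_facts L hL).2.1 h

/-- the forest law of a single law-OK sibling is its gated law. [this work] -/
theorem flaw_single (s : Sib) (hs : s.LawOK) : flaw [s] = gate s.ρ s.q := by
  funext h
  show lconv 0 s.M δ0 (gate s.ρ s.q) h = gate s.ρ s.q h
  refine lconv_delta_left 0 s.M _ (fun k hk => ?_) h
  obtain ⟨_, _, _, ρM, _⟩ := hs
  rw [gate_apply, ρM k hk, if_neg (by omega)]
  ring

/-- **if the forest law is ONE gated law and the scaled forest law is the same law at the scaled gate, the residual is that scaled gated law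
at every weight `w ≠ 1`** (`gate (gate ρ q) a = gate ρ (a q)`). [this work] -/
theorem resid_of_flaw_eq {a w q : ℝ} {ρ : ℕ → ℝ} {L : List Sib} (hw : w ≠ 1) (hF : flaw L = gate ρ q)
    (hFa : flaw (L.map (Sib.scale a)) = gate ρ (a * q)) : resid a w L = gate ρ (a * q) := by
  funext h
  show (gate (flaw L) a h - w * flaw (L.map (Sib.scale a)) h) / (1 - w) = gate ρ (a * q) h
  rw [hF, hFa, gate_gate]
  have hne : (1 - w) ≠ 0 := sub_ne_zero.2 (Ne.symm hw)
  rw [show gate ρ (a * q) h - w * gate ρ (a * q) h = gate ρ (a * q) h * (1 - w) by ring, mul_div_assoc, div_self hne, mul_one]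

/-! ### The refutation -/

/-- **THE PURE FORM `LightResidDECLaw` IS FALSE.**  Witness: `x = 99/200`, `L = [D, D, S]` with `D = (1/2, 1, 0, 0, δ₀)` (unit siblings) and
`S = (9/10, 11/20, 1, 10, ½δ₁ + ½δ₁₀)` (top-affordable with equality), `a = 9/10`: the residual is `gate (½δ₁ + ½δ₁₀) (81/100)`, of mean
`891/200 > 2`, and DEC at the dominant layer `1` would give the far row `891/2000 ≤ P(N ≥ 2) = 81/200` (`tail_ge_of_decAt`), which is false.
See the file header for the mechanism, the non-degenerate variants and the repair. [this work] -/
theorem not_lightResidDECLaw : ¬ LightResidDECLaw := by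
  intro hlaw
  -- the data
  set S : Sib := ⟨9 / 10, 11 / 20, 1, 10, ρ♭⟩ with hSdef
  set D : Sib := ⟨1 / 2, 1, 0, 0, δ0⟩ with hDdef
  set L : List Sib := [D, D, S] with hLdef
  have hρM : ∀ k, 10 < k → (ρ♭) k = 0 := fun k hk => by
    have h1 : k ≠ 1 := by omega
    have h2 : k ≠ 10 := by omega
    simp [h1, h2]
  have hρ1 : ∑ h ∈ Finset.range (10 + 1), (ρ♭) h = 1 := by
    simp only [Finset.sum_range_succ, Finset.sum_range_zero]
    norm_num
  have hSmean : S.mean = 11 / 2 := by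
    rw [hSdef]
    simp only [Sib.mean, Finset.sum_range_succ, Finset.sum_range_zero]
    norm_num
  have hDmean : D.mean = 0 := by
    rw [hDdef]
    simp only [Sib.mean, Finset.sum_range_succ, Finset.sum_range_zero]
    norm_num
  have hSlaw : S.LawOK := by
    refine ⟨by rw [hSdef]; norm_num, by rw [hSdef]; norm_num, fun h => ?_, fun h hh => ?_, ?_⟩
    · rw [hSdef]; simp only; split_ifs <;> norm_num
    · rw [hSdef] at hh ⊢; exact hρM h hh
    · rw [hSdef]; exact hρ1
  have hDlaw : D.LawOK := by
    refine ⟨by rw [hDdef]; norm_num, by rw [hDdef]; norm_num, fun h => ?_, fun h hh => ?_, ?_⟩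
    · rw [hDdef]; simp only; split_ifs <;> norm_num
    · rw [hDdef] at hh ⊢; simp only at hh ⊢; rw [if_neg (by omega)]
    · rw [hDdef]; simp
  -- scaled data
  have hSalaw : (S.scale (9 / 10)).LawOK := by
    refine ⟨by rw [hSdef]; simp only [Sib.scale]; norm_num, by rw [hSdef]; simp only [Sib.scale]; norm_num, fun h => ?_, fun h hh => ?_, ?_⟩
    · rw [hSdef]; simp only [Sib.scale]; split_ifs <;> norm_num
    · rw [hSdef] at hh ⊢; exact hρM h hh
    · rw [hSdef]; exact hρ1
  have hDalaw : (⟨9 / 10 * (1 / 2), 1, 0, 0, δ0⟩ : Sib).LawOK := by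
    refine ⟨by norm_num, by norm_num, fun h => ?_, fun h hh => ?_, ?_⟩
    · simp only; split_ifs <;> norm_num
    · simp only at hh ⊢; rw [if_neg (by omega)]
    · simp
  -- the family hypothesis at floor 99/200
  have hfam : SibFamAff₃ (99 / 200) L := by
    refine ⟨fun s hs => ?_, by rw [hLdef]; simp⟩
    rw [hLdef] at hs
    simp only [List.mem_cons, List.mem_nil_iff, or_false] at hs
    rcases hs with h | h | h
    · subst h
      refine ⟨hDlaw, by rw [hDdef]; norm_num, by rw [hDdef]; norm_num, ?_⟩
      rw [hDmean, hDdef]; norm_num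
    · subst h
      refine ⟨hDlaw, by rw [hDdef]; norm_num, by rw [hDdef]; norm_num, ?_⟩
      rw [hDmean, hDdef]; norm_num
    · subst h
      refine ⟨hSlaw, by rw [hSdef]; norm_num, by rw [hSdef]; norm_num, ?_⟩
      rw [hSmean, hSdef]; norm_num
  -- the forest laws and the residual
  have htop : ftop L = 10 := by rw [hLdef, hSdef, hDdef]; rfl
  have hF : flaw L = gate ρ♭ (9 / 10) := by
    rw [hLdef, hDdef, flaw_cons_unit _ _ _ _ (by
      intro s hs
      simp only [List.mem_cons, List.mem_nil_iff, or_false] at hs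
      rcases hs with h | h
      · rw [h]; exact hDlaw
      · rw [h]; exact hSlaw),
      flaw_cons_unit _ _ _ _ (by
      intro s hs
      simp only [List.mem_cons, List.mem_nil_iff, or_false] at hs
      rw [hs]; exact hSlaw), flaw_single S hSlaw, hSdef]
  have hFa : flaw (L.map (Sib.scale (9 / 10))) = gate ρ♭ (9 / 10 * (9 / 10)) := by
    have e : L.map (Sib.scale (9 / 10)) = [⟨9 / 10 * (1 / 2), 1, 0, 0, δ0⟩, ⟨9 / 10 * (1 / 2), 1, 0, 0, δ0⟩, S.scale (9 / 10)] := by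
      rw [hLdef, hDdef]; rfl
    rw [e, flaw_cons_unit _ _ _ _ (by
      intro s hs
      simp only [List.mem_cons, List.mem_nil_iff, or_false] at hs
      rcases hs with h | h
      · rw [h]; exact hDalaw
      · rw [h]; exact hSalaw),
      flaw_cons_unit _ _ _ _ (by
      intro s hs
      simp only [List.mem_cons, List.mem_nil_iff, or_false] at hs
      rw [hs]; exact hSalaw), flaw_single _ hSalaw, hSdef]
    rfl
  have hw1 : wco (9 / 10) L < 1 := by
    rw [hLdef]
    exact wco_lt_one (by norm_num) D D [S] (by
      intro s hs
      simp only [List.mem_cons, List.mem_nil_iff, or_false] at hs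
      rcases hs with h | h | h
      · rw [h]; exact hDlaw
      · rw [h]; exact hDlaw
      · rw [h]; exact hSlaw)
  have hres : resid (9 / 10) (wco (9 / 10) L) L = gate ρ♭ (9 / 10 * (9 / 10)) := resid_of_flaw_eq hw1.ne hF hFa
  -- DEC at the dominant layer 1 would give the far row there
  have hd := hlaw (99 / 200) L (by norm_num) (by norm_num) hfam (9 / 10) (by norm_num) (by norm_num) 1 (by rw [htop]; norm_num)
  rw [htop, hres] at hd
  have hmean : ∑ h ∈ Finset.range (10 + 1), (h : ℝ) * gate ρ♭ (9 / 10 * (9 / 10)) h = 891 / 200 := by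
    simp only [gate, Finset.sum_range_succ, Finset.sum_range_zero]
    norm_num
  have htail : ∑ h ∈ Finset.Ico (1 + 1) (10 + 1), gate ρ♭ (9 / 10 * (9 / 10)) h = 81 / 200 := by
    rw [Finset.sum_Ico_eq_sum_range]
    simp only [gate, Finset.sum_range_succ, Finset.sum_range_zero]
    norm_num
  have hrow := tail_ge_of_decAt (min (9 / 10 * (99 / 200)) (1 / 2)) 1 10 _ ((min_le_right _ _).trans (by norm_num)) hd
    (by rw [hmean]; norm_num)
  rw [htail, min_eq_left (by norm_num)] at hrow
  norm_num at hrow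

/-! ### The same failure with genuine relay companions: excluding unit siblings does not repair the pure form -/

/-- the sure relay `δ₁` -/
local notation3 "δ1" => (fun h : ℕ => if h = 1 then (1 : ℝ) else 0)

/-- **the far-blob mass of the forest `[R¹[q_e], R¹[q_e], (q, ½δ₁ + ½δ₁₀)]` above layer `3` is `q/2`** (only the blob reaches above `3`; the two relay
companions contribute the factor `((1 − q_e) + q_e)² = 1`). [this work] -/
theorem tail_flaw_relays_far (q qe x₁ x₁' : ℝ) (n n' : ℕ) :
    ∑ h ∈ Finset.Ico 4 13, flaw [⟨qe, x₁', n', 1, δ1⟩, ⟨qe, x₁', n', 1, δ1⟩, ⟨q, x₁, n, 10, ρ♭⟩] h = q / 2 := by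
  have e1 : lconv 0 10 δ0 (gate ρ♭ q) = gate ρ♭ q := by
    funext k
    refine lconv_delta_left 0 10 _ (fun i hi => ?_) k
    have h1 : i ≠ 1 := by omega
    have h2 : i ≠ 10 := by omega
    have h0 : i ≠ 0 := by omega
    simp [gate, h0, h1, h2]
  show ∑ h ∈ Finset.Ico 4 13, lconv 11 1 (lconv 10 1 (lconv 0 10 δ0 (gate ρ♭ q)) (gate δ1 qe)) (gate δ1 qe) h = q / 2
  rw [e1, Finset.sum_Ico_eq_sum_range]
  simp only [Finset.sum_range_succ, Finset.sum_range_zero, lconv, gate]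
  norm_num
  ring

/-- **THE PURE FORM FAILS WITH RELAY COMPANIONS TOO**: `LightResidDECOn` is false on the family of lists of `≥ 3` aff-OK siblings EACH WITH AT LEAST
ONE RELAY (`1 ≤ M`).  Witness: `x = 99/200`, `L = [E, E, S]`, `E = (9/10, 1, 0, 1, δ₁)` (a sure relay behind the gate `9/10` — a tree-built law),
`S = (9/10, 11/20, 1, 10, ½δ₁ + ½δ₁₀)` (top-affordable with equality), `a = 9/10`: the residual has mean `243/40 > 6`, so layer `3` is dominant, and its
mass above `3` is the far-blob mass `81/200 < 891/2000 = a·x` — the far row fails (`tail_ge_of_decAt`).  With the TREE floor `x₁ = 1/2` of `S`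
the same forest is IN at every layer (census-1 exact LP). [this work] -/
theorem not_lightResidDECOn_affOK_relays :
    ¬ LightResidDECOn (fun x L => (∀ s ∈ L, s.AffOK x ∧ 1 ≤ s.M) ∧ 3 ≤ L.length) := by
  intro hlaw
  set S : Sib := ⟨9 / 10, 11 / 20, 1, 10, ρ♭⟩ with hSdef
  set E : Sib := ⟨9 / 10, 1, 0, 1, δ1⟩ with hEdef
  set L : List Sib := [E, E, S] with hLdef
  have hρM : ∀ k, 10 < k → (ρ♭) k = 0 := fun k hk => by
    have h1 : k ≠ 1 := by omega
    have h2 : k ≠ 10 := by omega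
    simp [h1, h2]
  have hρ1 : ∑ h ∈ Finset.range (10 + 1), (ρ♭) h = 1 := by
    simp only [Finset.sum_range_succ, Finset.sum_range_zero]
    norm_num
  have hδM : ∀ k, 1 < k → (δ1) k = 0 := fun k hk => by
    have h1 : k ≠ 1 := by omega
    simp [h1]
  have hδ1 : ∑ h ∈ Finset.range (1 + 1), (δ1) h = 1 := by
    simp only [Finset.sum_range_succ, Finset.sum_range_zero]
    norm_num
  have hSmean : S.mean = 11 / 2 := by
    rw [hSdef]
    simp only [Sib.mean, Finset.sum_range_succ, Finset.sum_range_zero]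
    norm_num
  have hEmean : E.mean = 1 := by
    rw [hEdef]
    simp only [Sib.mean, Finset.sum_range_succ, Finset.sum_range_zero]
    norm_num
  have hSlaw : S.LawOK := by
    refine ⟨by rw [hSdef]; norm_num, by rw [hSdef]; norm_num, fun h => ?_, fun h hh => ?_, ?_⟩
    · rw [hSdef]; simp only; split_ifs <;> norm_num
    · rw [hSdef] at hh ⊢; exact hρM h hh
    · rw [hSdef]; exact hρ1
  have hElaw : E.LawOK := by
    refine ⟨by rw [hEdef]; norm_num, by rw [hEdef]; norm_num, fun h => ?_, fun h hh => ?_, ?_⟩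
    · rw [hEdef]; simp only; split_ifs <;> norm_num
    · rw [hEdef] at hh ⊢; exact hδM h hh
    · rw [hEdef]; exact hδ1
  have hL : ∀ s ∈ L, s.LawOK := by
    intro s hs
    rw [hLdef] at hs
    simp only [List.mem_cons, List.mem_nil_iff, or_false] at hs
    rcases hs with h | h | h
    · rw [h]; exact hElaw
    · rw [h]; exact hElaw
    · rw [h]; exact hSlaw
  -- the family hypothesis at floor 99/200
  have hfam : (∀ s ∈ L, s.AffOK (99 / 200) ∧ 1 ≤ s.M) ∧ 3 ≤ L.length := by
    refine ⟨fun s hs => ?_, by rw [hLdef]; simp⟩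
    rw [hLdef] at hs
    simp only [List.mem_cons, List.mem_nil_iff, or_false] at hs
    rcases hs with h | h | h
    · subst h
      refine ⟨⟨hElaw, by rw [hEdef]; norm_num, by rw [hEdef]; norm_num, ?_⟩, by rw [hEdef]⟩
      rw [hEmean, hEdef]; norm_num
    · subst h
      refine ⟨⟨hElaw, by rw [hEdef]; norm_num, by rw [hEdef]; norm_num, ?_⟩, by rw [hEdef]⟩
      rw [hEmean, hEdef]; norm_num
    · subst h
      refine ⟨⟨hSlaw, by rw [hSdef]; norm_num, by rw [hSdef]; norm_num, ?_⟩, by rw [hSdef]; norm_num⟩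
      rw [hSmean, hSdef]; norm_num
  have htop : ftop L = 12 := by rw [hLdef, hSdef, hEdef]; rfl
  have hfmean : fmean L = 27 / 4 := by
    rw [hLdef]
    simp only [fmean]
    rw [hSmean, hEmean, hSdef, hEdef]
    norm_num
  -- the residual: law facts, mean, and its mass above layer 3
  have hw1 : wco (9 / 10) L < 1 := by rw [hLdef]; exact wco_lt_one (by norm_num) E E [S] (by rw [← hLdef]; exact hL)
  obtain ⟨_, _, _, rmn⟩ := resid_laws (a := 9 / 10) (by norm_num) (by norm_num) L hL le_rfl hw1
  rw [htop, hfmean] at rmn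
  have htailF : ∑ h ∈ Finset.Ico 4 13, flaw L h = 9 / 10 / 2 := by
    rw [hLdef, hEdef, hSdef]; exact tail_flaw_relays_far _ _ _ _ _ _
  have htailFa : ∑ h ∈ Finset.Ico 4 13, flaw (L.map (Sib.scale (9 / 10))) h = 9 / 10 * (9 / 10) / 2 := by
    have e : L.map (Sib.scale (9 / 10)) = [⟨9 / 10 * (9 / 10), 1, 0, 1, δ1⟩, ⟨9 / 10 * (9 / 10), 1, 0, 1, δ1⟩,
        ⟨9 / 10 * (9 / 10), 11 / 20, 1, 10, ρ♭⟩] := by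
      rw [hLdef, hEdef, hSdef]; rfl
    rw [e]; exact tail_flaw_relays_far _ _ _ _ _ _
  have htailG : ∑ h ∈ Finset.Ico 4 13, gate (flaw L) (9 / 10) h = 9 / 10 * (9 / 10 / 2) := by
    rw [← htailF, Finset.mul_sum]
    refine Finset.sum_congr rfl fun h hh => ?_
    have h4 : 4 ≤ h := (Finset.mem_Ico.1 hh).1
    rw [gate_apply, if_neg (by omega)]
    ring
  have htail : ∑ h ∈ Finset.Ico (3 + 1) (12 + 1), resid (9 / 10) (wco (9 / 10) L) L h = 81 / 200 := by
    have hne : (1 - wco (9 / 10) L) ≠ 0 := by linarith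
    show ∑ h ∈ Finset.Ico 4 13, (gate (flaw L) (9 / 10) h - wco (9 / 10) L * flaw (L.map (Sib.scale (9 / 10))) h) /
        (1 - wco (9 / 10) L) = 81 / 200
    rw [← Finset.sum_div, Finset.sum_sub_distrib, ← Finset.mul_sum, htailG, htailFa,
      show (9 / 10 * (9 / 10 / 2) : ℝ) - wco (9 / 10) L * (9 / 10 * (9 / 10) / 2) = 81 / 200 * (1 - wco (9 / 10) L) by ring,
      mul_div_assoc, div_self hne, mul_one]
  -- DEC at the dominant layer 3 would give the far row there
  have hd := hlaw (99 / 200) L (by norm_num) (by norm_num) hfam (9 / 10) (by norm_num) (by norm_num) 3 (by rw [htop]; norm_num)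
  rw [htop] at hd
  have hrow := tail_ge_of_decAt (min (9 / 10 * (99 / 200)) (1 / 2)) 3 12 _ ((min_le_right _ _).trans (by norm_num)) hd
    (by rw [rmn]; norm_num)
  rw [htail, min_eq_left (by norm_num)] at hrow
  norm_num at hrow

end LawDec

end Quant

end Summit.CriticalPhenomena.PercolationContinuityZ3.Theorems
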